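import Summits.HodgeConjecture.HodgeConjecture.Theorems.TropicalWeilObstructionTropicalHodgeBoundCertDataA
import Summits.HodgeConjecture.HodgeConjecture.Theorems.TropicalWeilObstructionTropicalHodgeBoundCertDataD

/-!
# Crux `TropicalHodgeBound` (stmt-HodgeConjecture-18480), stub 4 — part C4.1: kernel run of the
# certificate, chunks 0–6

Route `TropicalWeilObstruction` of `HodgeConjecture`, registered line `birth`, stub
`stub_rationalHodgeCoordinates`. Each theorem states that one chunk of the propagation certificate
(`…CertData*`) passes the checker `Chk.checkChunk` of `…ChkCore` (incoming boundary facts, packed steps,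
outgoing boundary facts, final unknowns); proved by `decide +kernel` (pure integer/list computation,
≈ 10⁶–10⁷ kernel reductions per chunk, hence the raised `maxHeartbeats`/`maxRecDepth`). Soundness of the
checker (`…CheckerSound`, `…CheckerEquations`) turns these into linear relations among the integer
coordinates of a tropical cycle class (`…Certificate`).

References: [Zharkov2020TropicalWeil] I. Zharkov, arXiv:2002.02347, §2; [MikhalkinZharkov2014Eigenwave]
G. Mikhalkin, I. Zharkov, LN UMI 15 (2014), Thm. 5.4.
-/

set_option linter.dupNamespace false

namespace Summit.HodgeConjecture.HodgeConjecture.Theorems.TropicalHodgeBound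

namespace Chk

set_option maxRecDepth 100000 in
set_option maxHeartbeats 400000000 in
/-- Chunk `0` of the certificate passes the checker. [cite: Zharkov2020TropicalWeil, §2] -/
theorem chunk0_ok : checkChunk [] ch0 bfA1 [] = true := by
  decide +kernel

set_option maxRecDepth 100000 in
set_option maxHeartbeats 400000000 in
/-- Chunk `1` of the certificate passes the checker. [cite: Zharkov2020TropicalWeil, §2] -/
theorem chunk1_ok : checkChunk bfA1 ch1 bfA2 [] = true := by
  decide +kernel

set_option maxRecDepth 100000 in
set_option maxHeartbeats 400000000 in
/-- Chunk `2` of the certificate passes the checker. [cite: Zharkov2020TropicalWeil, §2] -/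
theorem chunk2_ok :
    checkChunk bfA2 ch2 [] ((ch0 ++ ch1 ++ ch2).map stepTarget ++ [0, 4, 14]) = true := by
  decide +kernel

set_option maxRecDepth 100000 in
set_option maxHeartbeats 400000000 in
/-- Chunk `3` of the certificate passes the checker. [cite: Zharkov2020TropicalWeil, §2] -/
theorem chunk3_ok : checkChunk [] ch3 bfB1 [] = true := by
  decide +kernel

set_option maxRecDepth 100000 in
set_option maxHeartbeats 400000000 in
/-- Chunk `4` of the certificate passes the checker. [cite: Zharkov2020TropicalWeil, §2] -/
theorem chunk4_ok : checkChunk bfB1 ch4 bfB2 [] = true := by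
  decide +kernel

set_option maxRecDepth 100000 in
set_option maxHeartbeats 400000000 in
/-- Chunk `5` of the certificate passes the checker. [cite: Zharkov2020TropicalWeil, §2] -/
theorem chunk5_ok : checkChunk bfB2 ch5 [] ((ch3 ++ ch4 ++ ch5).map stepTarget) = true := by
  decide +kernel

set_option maxRecDepth 100000 in
set_option maxHeartbeats 400000000 in
/-- Chunk `6` of the certificate passes the checker. [cite: Zharkov2020TropicalWeil, §2] -/
theorem chunk6_ok : checkChunk [] ch6 [] (ch6.map stepTarget) = true := by
  decide +kernel

end Chk

end Summit.HodgeConjecture.HodgeConjecture.Theorems.TropicalHodgeBound
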